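import Summits.QuantumFields.YangMills.Theorems.UnitScaleTiltProp7NormHoneFamilyPackageAllMembers
import Summits.QuantumFields.YangMills.Theorems.UnitScaleTiltProp7StubEXOfChartPiecesTwS49
import HarnessLib

/-!
# «S50» — THE EX DISPLAY WITH THE PRINT ROW `norm_H₁` ((6): `‖H₁‖` at the slot Δ₁ = Δ^η + T_Jᴾ) DISCHARGED FOR ALL MEMBERS modulo the row's displayed site-Hessian letter `hqG`
# (EX display producer px10 g15; statement = TREE S49 VERBATIM except: census removed [norm_H₁] · added [αq qG hαq hqG hqGrow] (★★OWNER №122: «open analytic letter», admissible like `hThm2S`;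
# text VERBATIM = ✓`normHone_family_exists_allMembers`' binders, placed where `norm_H₁` stood) · changed [] · conclusion IDENTICAL = the registered stub text (f199ee1aea9feec8);
# ZERO no-wrap-ROOM tokens; `B₀` stays displayed for `norm_G` and S49 is fed `max (B₀ L) (BH L)`).
# Fed by ✓`Prop7NormHoneFamilyPackageAllMembers.normHone_family_exists_allMembers` (px17 g13 O2-R) at the window `a₀ := 1`, `a₁ := max A₁ 1`.
# PROOF = one `obtain` + cap `min (αcap L) (αN L)` + ONE `exact stubEX_of_chartPiecesTwS49 …` BY NAME (namer w2 g12 `gen_sevent.py` architecture incl. `--b0max`; script `gen_s50.py`).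
# CONDITIONAL (the remaining print row `norm_G` + the letters `hqG`, `hThm2S` displayed); `--supports stmt-QuantumFields-19200 --as helper`;
# rung R3 = SU(2) YM₃ on T³ — NOT d = 4, NOT infinite volume, NOT a mass gap, NOT Clay.
-/

set_option autoImplicit false

noncomputable section

open scoped BigOperators Matrix.Norms.L2Operator Matrix InnerProductSpace

namespace Summit.QuantumFields.YangMills.Theorems.Prop7StubEXOfChartPiecesTwS50

open NormedSpace
open Literature.Analysis.Calculus.ExpDifferential (ad gSer)
open Literature.MathematicalPhysics.QuantumFieldTheory.Balaban1983to89
open Literature.MathematicalPhysics.QuantumFieldTheory.Balaban1983to89.T3ContinuumYM3Torus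
open Literature.MathematicalPhysics.QuantumFieldTheory.Balaban1983to89.T3UnitLawDensityEML (ℰp)
open Literature.MathematicalPhysics.QuantumFieldTheory.Balaban1983to89.T3TiltDescent (descendTo)
open Literature.MathematicalPhysics.QuantumFieldTheory.Balaban1983to89.T3ConstrainedMinimiser (fibre)
open Literature.MathematicalPhysics.QuantumFieldTheory.Balaban1983to89.T3PrintedRegularMinimiser (RegPr regFibrePr)
open Literature.MathematicalPhysics.QuantumFieldTheory.Balaban1983to89.T3Thm1Carrier
open Literature.MathematicalPhysics.QuantumFieldTheory.Balaban1983to89.T3SectALandauChart (In19 emb15 CloseAvg eta bgUnits pert)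
open B9SectCLatticeCarrier (Bond)
open B9Eq311L2Pairing (WL2)
open B10Eq27TorusAxialLog (unitsField toUField pull transl holT)
open B11Eq115Space (NegSup NegSize Space115 JetSup levWeight)
open B11Eq111FrakG (nabla115)
open B11Eq98CurrentSlot (Jcur)
open B11Eq103H1Complex (BondL2K funEquiv SiteL2K laplaceAK)
open B11Prop3Model (Dfix)
open B13Contraction113 (QuadAnalytic)
open B8Thm2SetupTorus (Thm2SetupSUAt)
open MatrixLog (mlog)
open Summit.QuantumFields.YangMills.Theorems.Prop7TPrint (nMax19 expHermField)
open Summit.QuantumFields.YangMills.Theorems.Prop7SPrint (NormS IsLandauPrintS basePt RestrictedPrint isLandauPrintS_iff_RS AvgCondPrint IsLandauPrint)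
open Summit.QuantumFields.YangMills.Theorems.Prop7SectET3Transport (periodsT3 bgOfCfg bondEquiv)
open Summit.QuantumFields.YangMills.Theorems.Prop7SectET3HilbertLetters (W₂ toL2 toL2B DL2 DstarL2 frobEquiv covLapSite toL2S)
open Summit.QuantumFields.YangMills.Theorems.Prop7SectET3GaugeProjector (RS)
open Summit.QuantumFields.YangMills.Theorems.Prop7SymAvgTwSym (QTwS CmapTwS Chart47T3twS)
open Summit.QuantumFields.YangMills.Theorems.Prop7SymAvgGL (QSym descendToGL)
open Summit.QuantumFields.YangMills.Theorems.Prop7SectET3CurvedPropagators (laplaceA PosOnto frakGfR H1f QTwS_Hf Qk GT KinvT)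
open Summit.QuantumFields.YangMills.Theorems.Prop7SectET3DeltaPiPInv (DeltaPiSlotP H46P inner_DL2_DeltaPiP_eq_zero GprimeP)
open Summit.QuantumFields.YangMills.Theorems.Prop7SectET3DeltaOnePInv (DeltaOnePJ TJSlotP DeltaOneP_kills_NS inner_DL2_DeltaOneP_eq_zero)
open Summit.QuantumFields.YangMills.Theorems.Prop7HDsolAtRecordOfRowsTwoSlotFamilyLLift (hΔsol_of_opRows_twoSlot_familyL)
open Summit.QuantumFields.YangMills.Theorems.Prop7HWROfRowsFamily (hWR_of_rows_family)
open Summit.QuantumFields.YangMills.Theorems.Prop7Prop4OfW80RowsAtRecord (prop4_W80_family)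
open Summit.QuantumFields.YangMills.Theorems.Prop7DeltaEtaHfCompositeNorm (hN₁_family_of_rows)
open Summit.QuantumFields.YangMills.Theorems.Prop7RieszTauFrobNorm (opNorm_rieszτ_frobEquiv_le_one opNorm_trace_clm_le_two hqV_record_family)
open Summit.QuantumFields.YangMills.Theorems.Prop7V0CurrentReality (hV0_of_RC_family)
open Summit.QuantumFields.YangMills.Theorems.Prop7ThetaOfColumnLettersT3 (theta_rows_family_of_columnLetters)
open Summit.QuantumFields.YangMills.Theorems.Prop7RCOfRowsFamily (hRC_of_rows_family_B₀)
open Summit.QuantumFields.YangMills.Theorems.Prop7RealityRowsFamily (hHfR_family hH₁R_family h𝒢R_family)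
open B11Eq63V0GroupCurrent (curV0)
open B11Eq80Current (Emap E3 W80)
open B11Eq90Transpose (kernel single115)
open B11Eq90V0primeCurrent (flat115)
open B11Eq174Chart (Regime)
open B11Eq90V0GroupComposed (curV0full T47)
open Summit.QuantumFields.YangMills.Theorems.Prop7SectET3EXJunction (h102_of_posOnto h129_of_posOnto h45_of_posOnto h102LS_of_posOnto h129LS_of_posOnto)
open Summit.QuantumFields.YangMills.Theorems.Prop7H46GradRow (h46_rows_of_norm115)
open Summit.QuantumFields.YangMills.Theorems.Prop7QkOntoOfRegPr (surjective_Qk_of_regPr)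
open T3SectALandauChart (bgUnits covGradT covCodiffCurlT covLapFormT)

open Summit.QuantumFields.YangMills.Theorems.Prop7SectET3WilsonHessian (DeltaEta DeltaEtaSlot)
open Summit.QuantumFields.YangMills.Theorems.Prop7H46TwoOfOpRowsFamily (hBH₂_of_nonneg)
open Summit.QuantumFields.YangMills.Theorems.Prop7HDsolAtRecordOfRowsFamily (hMΔ_of_nonneg)
open Summit.QuantumFields.YangMills.Theorems.Prop7H46PTwoOfOpRowsFamily (h46₂P_of_opRows_family)

open B11Eq98V0primeCurrentSlots (rieszτ)
open B9Eq3119DeltaPiCarrier (currentCLM)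
open Summit.QuantumFields.YangMills.Theorems.Prop7ColumnRowsOfKernelDecay (hHcol_of_kernel133_family hΔHcol_of_kernel88_family thetaH_nonneg thetaΔ_nonneg)
open Summit.QuantumFields.YangMills.Theorems.Prop7Op349OfKernelRow (hOp349_of_kernel349_family k349_nonneg)
open Summit.QuantumFields.YangMills.Theorems.Prop7PA2OfSymDiffDivRows (hPA2_of_symL1_diffL1_divSlice)
open Summit.QuantumFields.YangMills.Theorems.Prop7DivSliceRowHolds (hV_holds)
open Summit.QuantumFields.YangMills.Theorems.Prop7HcoSOfNormG0DiffRow (hS_holds)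
open Summit.QuantumFields.YangMills.Theorems.Prop7StubEXOfChartPiecesTwS25LLift (stubEX_of_chartPiecesTwS25L)
open Summit.QuantumFields.YangMills.Theorems.Prop7Op139OfGaugeColumnLift (hOp139π_of_gaugeColumn_family)
open Summit.QuantumFields.YangMills.Theorems.Prop7Op139OfGaugeColumn (k139_nonneg)
open Summit.QuantumFields.YangMills.Theorems.Prop7DivRecoveryPatchRows (patch_rows)
open Summit.QuantumFields.YangMills.Theorems.Prop7QH1DoorHolds (hQH1_doorH_holds)
open Summit.QuantumFields.YangMills.Theorems.Prop7HN06OfPatch (hN06_of_patchRows)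
open Summit.QuantumFields.YangMills.Theorems.Prop7CombHMc2Holds (hMc₂_holds)
open Summit.QuantumFields.YangMills.Theorems.Prop7N32SymRow (hN2s_holds)
open Summit.QuantumFields.YangMills.Theorems.Prop7CombHMcombHolds (hMcomb_holds)
open Literature.MathematicalPhysics.QuantumLattice (blockBase)
open T3LevelShift (bondShift siteShift)
open B7Eq78Linearization (conjR)
open B7Prop1Explicit (U1 expUnit)
open T4TermwiseTorus (tlift)
open Summit.QuantumFields.YangMills.Theorems.Prop7QprimeCombL2 (RcombL2)
open B7Eq92Concrete (tildIter)
open BlockAveragingEMLLinearisedBackground (pertVar)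
open ExpMeanLog (expMeanLogSU)
open BlockAveraging (blockAvg)
open Summit.QuantumFields.YangMills.Theorems.Prop7CovKernel157Family (hC157_family)
open B9Eq39Adjoint (curl divB)
open B9TorusCalculus (torusT)
open Summit.QuantumFields.YangMills.Theorems.Prop7SectET3CombLetters (Qkc)
open Summit.QuantumFields.YangMills.Theorems.Prop7SymAvgTw (CmapTw)
open Summit.QuantumFields.YangMills.Theorems.Prop7CcolOf157Entry (hCcol_of_157_family hG0_of_hg0)
open Prop8Chart (emlIterU)
open B15DeterminingSets (embIter)
open Summit.QuantumFields.YangMills.Theorems.Prop7Op137OfKernelRows (h137π_of_kernel137_family h137Δ_of_kernel137_family hOpC_of_kernelC_family)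
open B5Eq118OneStroke (iterBlockOf)
open T3PrintedRegularOrbits (sites_eq)
open Summit.QuantumFields.YangMills.Theorems.Prop7CmapTwSupRow (hcoS_of_normG0_of_combRemainderL1Rows)
open Summit.QuantumFields.YangMills.Theorems.Prop7HDOfCombRows (hD_of_hMcomb)
open Summit.QuantumFields.YangMills.Theorems.Prop7IrrLiftRowOfRecord (hIrrLift_of_record)
open Summit.QuantumFields.YangMills.Theorems.Prop7EXNumeralRowsInhabited (ex_numeral_rows_inhabited)

open Summit.QuantumFields.YangMills.Theorems.Prop7StubEXOfChartPiecesTwS43LT2 (stubEX_of_chartPiecesTwS43LT2)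
open Summit.QuantumFields.YangMills.Theorems.Prop7PositivityBlockDoorLiftedRows (positivityRows_lift_of_liftedRows)
open Summit.QuantumFields.YangMills.Theorems.Prop7TJRowOfEntry157Lift (hTJ_of_hHcol_h157)
open Summit.QuantumFields.YangMills.Theorems.Prop7ColumnRowsOfKernelDecayLift (hHcol_of_kernel133_family)

open Summit.QuantumFields.YangMills.Theorems.Prop7StubEXOfChartPiecesTwS44LG (stubEX_of_chartPiecesTwS44LG)
open Summit.QuantumFields.YangMills.Theorems.Prop7GaugeFixedRowDoorOfLODTarget (gaugeFixedRow_idx_of_curvedTarget_of_le_coupling)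
open T3PrintedMinimiserExistence (regPr_mono)
open B7TransferAnalyticMean (meanCLM)
open B11Eq103H1Complex (projR)
open Summit.QuantumFields.YangMills.Theorems.Prop7SectET3GaugeProjector (NS)
open B7Prop1Explicit (disp)
open T4Continuum BlockAveraging

open Summit.QuantumFields.YangMills.Theorems.Prop7StubEXOfChartPiecesTwS45 (stubEX_of_chartPiecesTwS45)
open Summit.QuantumFields.YangMills.Theorems.Prop7KernelRow349DoorOfLODTarget (kernelRow349_idx_of_projRTarget)
open T3PrintedMinimiserExistence (regPr_mono)
open B7TransferAnalyticMean (meanCLM)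
open B11Eq103H1Complex (projR)
open Summit.QuantumFields.YangMills.Theorems.Prop7SectET3GaugeProjector (NS)
open B7Prop1Explicit (disp)
open T4Continuum BlockAveraging

open Summit.QuantumFields.YangMills.Theorems.Prop7StubEXOfChartPiecesTwS46 (stubEX_of_chartPiecesTwS46)
open T3PrintedMinimiserExistence (regPr_mono)
open B7TransferAnalyticMean (meanCLM)
open B11Eq103H1Complex (projR)
open Summit.QuantumFields.YangMills.Theorems.Prop7SectET3GaugeProjector (NS)
open B7Prop1Explicit (disp)
open T4Continuum BlockAveraging
open Summit.QuantumFields.YangMills.Theorems.Prop7StubEXOfChartPiecesTwS47 (stubEX_of_chartPiecesTwS47)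
open Summit.QuantumFields.YangMills.Theorems.Prop7H133FamilyPackageAllMembers (h133_family_exists_allMembers h137kpi_family_exists_allMembers)
open T3PrintedMinimiserExistence (regPr_mono)
open Summit.QuantumFields.YangMills.Theorems.Prop7StubEXOfChartPiecesTwS48 (stubEX_of_chartPiecesTwS48)
open Summit.QuantumFields.YangMills.Theorems.Prop7NormHpiFamilyPackageAllMembers (normHpi_family_exists_allMembers)
open Summit.QuantumFields.YangMills.Theorems.Prop7H88FamilyPackageAllMembers (h88_family_exists_allMembers)
open Summit.QuantumFields.YangMills.Theorems.Prop7KRows78EtaTJFamilyPackageAllMembers (hCk_family_exists_allMembers)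
open Summit.QuantumFields.YangMills.Theorems.Prop7KRows78EtaTJFamilyPackageAllMembers (h137kDelta_family_exists_allMembers)
open T3PrintedMinimiserExistence (regPr_mono)
open Summit.QuantumFields.YangMills.Theorems.Prop7StubEXOfChartPiecesTwS49 (stubEX_of_chartPiecesTwS49)
open Summit.QuantumFields.YangMills.Theorems.Prop7NormHoneFamilyPackageAllMembers (normHone_family_exists_allMembers)
open Summit.QuantumFields.YangMills.Theorems.Prop7SectET3DeltaOne (avgHess)
open T3PrintedMinimiserExistence (regPr_mono)

set_option maxHeartbeats 400000 in
-- HEARTBEAT rule (README): one `obtain` + `have`s + one 13-argument `exact` by name; decl-local.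
/-- («S50».) S49's rows VERBATIM except: the print row `norm_H₁` is DISCHARGED for ALL members — fed by ✓`normHone_family_exists_allMembers` (px17 O2-R, ROOM-free) at the coupling window
`[1, max A₁ 1]·(c₀∕cB)·(L^{K−n})³`; its displayed site-Hessian letter `hqG` (`αq qG hαq hqG hqGrow`, text VERBATIM) becomes a display letter; `B₀` is fed `max (B₀ L) (BH L)`; ONE `exact` into
✓`stubEX_of_chartPiecesTwS49` at the cap `min (αcap L) (αN L)`.  CONDITIONAL — 1 print row (`norm_G`) + `hqG` + `hThm2S` displayed.
[cite: Balaban1985Variational, Prop. 7 p.299, (138)–(139) p.299, (141)-(142) p.299; Balaban1985BackgroundPropagators, Thm 3.1 (3.42)∕(3.46) pp.397–398, (3.49) p.399, Thm 3.12 (3.132)–(3.133) p.422; Balaban1985RegularSpaces, Thm 2 p.83; Balaban1985Averaging, Props 4–5 pp.38–42] -/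
theorem stubEX_of_chartPiecesTwS50
    [hFL : ∀ F : T3Family, Fact (0 < (F.L : ℝ))]
    [hFη : ∀ (F : T3Family) (k : ℕ), Fact (0 < ((F.L : ℝ)⁻¹) ^ k)]
    (B₀ : ℕ → ℝ)
    (hB₀ : ∀ L, 1 < L → 0 < B₀ L)
    -- (PRINT-SHAPE EVENT) the ONE regularity cap below which every print row is asked («for U₀ ∈ 𝔄(ρ), ρ ≤ αcap» — [B9] Thm 3.3∕3.11∕3.12 shape); the census letters `C₄ a₃ α r M εC ef ε′`
    -- (with `α ≤ αcap`) and ALL 23 numeral rows + their 6 signs are chosen INSIDE the proof by ✓`Prop7EXNumeralRowsInhabited.ex_numeral_rows_inhabited` (px19 g7 ∕ ★p1 g20 SIGNATURE-0)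
    (αcap : ℕ → ℝ) (hαcap : ∀ L : ℕ, 1 < L → 0 < αcap L)
    (c₀ cB : ℕ → ℝ)
    [hc₀ : ∀ L : ℕ, Fact (0 < c₀ L)]
    [hcB : ∀ L : ℕ, Fact (0 < cB L)]
    (a : ∀ L : ℕ, Idx L → ℝ)
    -- (S45, ★★OWNER WORD 63 shape (B)) the display's coupling `a` is FREE above the LOD line's coupling `a₀·(c₀∕cB)·(L^{K−n})³` (`a₀ := 1`): the ONE changed row
    (ha : ∀ (L : ℕ) (i : Idx L), (c₀ L / cB L) * ((i.1.1.L : ℝ) ^ (i.1.2.2 - i.1.2.1)) ^ 3 ≤ a L i)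
    -- (S48, ★★OWNER RECORD 17cz (b)) the ONE new display letter: the coupling's UPPER pin, so that the K-storey's two-sided coupling window `[1, max A₁ 1]·(c₀∕cB)·(L^{K−n})³` holds
    (A₁ : ℝ)
    (hA₁ : ∀ L : ℕ, 1 < L → ∀ i : Idx L, a L i ≤ A₁ * ((c₀ L / cB L) * ((i.1.1.L : ℝ) ^ (i.1.2.2 - i.1.2.1)) ^ 3))
    (norm_G : ∀ (L : ℕ), 1 < L → ∀ (i : Idx L) (ρ : ℝ) (U₀ : GaugeField (i.1.1.P i.1.2.2) 0 (Matrix.specialUnitaryGroup (Fin 2) ℂ)),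
      RegPr i.1.1 i.1.2.1 i.1.2.2 ρ U₀ → ρ ≤ αcap L →
        -- LIFT-THREAD 2: the `Lift L i U₀` antecedent of record (w2 g6; discharged at the junction by ✓`hIrrLift_of_record`)
        (∀ cf : Site (i.1.1.P i.1.2.2) (i.1.2.2 - i.1.2.1) → Matrix (Fin 2) (Fin 2) ℂ,
        (∀ e' : PBond (i.1.1.P i.1.2.2) (i.1.2.2 - i.1.2.1), cf e'.src = ((emlIterU (i.1.2.2 - i.1.2.1) (bgUnits i.1.1 i.1.2.2 U₀) e' : (Matrix (Fin 2) (Fin 2) ℂ)ˣ) : Matrix (Fin 2) (Fin 2) ℂ) * cf e'.tgt *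
        (((emlIterU (i.1.2.2 - i.1.2.1) (bgUnits i.1.1 i.1.2.2 U₀) e')⁻¹ : (Matrix (Fin 2) (Fin 2) ℂ)ˣ) : Matrix (Fin 2) (Fin 2) ℂ)) →
        ∃ l₀ : Site (i.1.1.P i.1.2.2) 0 → Matrix (Fin 2) (Fin 2) ℂ,
        (∀ b' : PBond (i.1.1.P i.1.2.2) 0, l₀ b'.src = ((bgUnits i.1.1 i.1.2.2 U₀ b' : (Matrix (Fin 2) (Fin 2) ℂ)ˣ) : Matrix (Fin 2) (Fin 2) ℂ) * l₀ b'.tgt * (((bgUnits i.1.1 i.1.2.2 U₀ b')⁻¹ : (Matrix (Fin 2) (Fin 2) ℂ)ˣ) : Matrix (Fin 2) (Fin 2) ℂ)) ∧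
        ∀ y : Site (i.1.1.P i.1.2.2) (i.1.2.2 - i.1.2.1), l₀ (embIter (i.1.2.2 - i.1.2.1) y) = cf y) →
        ∀ f, ‖frakGfR i.1.1 i.1.2.1 i.1.2.2 i.2.2.le (c₀ L) (cB L) (a L i) (DeltaOnePJ i.1.1 i.1.2.1 i.1.2.2 i.2.2.le (c₀ L) (cB L) (a L i)) U₀ f‖ ≤ B₀ L * ‖f‖)
    -- (S50, ★★OWNER №122 class «open analytic letter») the row-(6) supplier's displayed site-Hessian letter `hqG` ([BackgroundPropagators] (3.42)–(3.44) class), VERBATIM = ✓`normHone_family_exists_allMembers`' binders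
    (αq qG : ℕ → ℝ) (hαq : ∀ L : ℕ, 1 < L → 0 < αq L) (hqG : ∀ L : ℕ, 1 < L → 0 ≤ qG L)
    (hqGrow : ∀ (L : ℕ), 1 < L → ∀ (i : Idx L) (U₀ : GaugeField (i.1.1.P i.1.2.2) 0 (Matrix.specialUnitaryGroup (Fin 2) ℂ)), RegPr i.1.1 i.1.2.1 i.1.2.2 (αq L) U₀ →
      ∀ (X' : PBond (i.1.1.P i.1.2.2) 0 → Matrix (Fin 2) (Fin 2) ℂ) (s : ℝ) (x : Site (i.1.1.P i.1.2.2) 0) (A : Matrix (Fin 2) (Fin 2) ℂ), (∀ b, ‖X' b‖ ≤ s) →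
        ∑ y : PBond (i.1.1.P i.1.2.1) 0, ‖avgHess i.1.1 i.1.2.1 i.1.2.2 i.2.2.le U₀ X'
            ((toL2 i.1.1 i.1.2.2 (c₀ L)).symm (DL2 i.1.1 i.1.2.1 i.1.2.2 (c₀ L) U₀ (toL2S i.1.1 i.1.2.2 (c₀ L) (Pi.single x A)))) y‖
          ≤ qG L * ((L : ℝ) ^ (i.1.2.2 - i.1.2.1))⁻¹ * s * ‖A‖)
    (hThm2S : ∀ (L : ℕ), 1 < L → ∃ B₁ c₁ : ℝ, 0 < B₁ ∧ 0 < c₁ ∧ ∀ (F : T3Family), F.L = L → ∀ (n K : ℕ), n < K →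
      ∃ (β₀ B₂ : ℝ) (len : B7Prop1Explicit.Site (F.P K).d → ℝ),
        Thm2SetupSUAt (F.P K) 2 (K - n) (eta F n K) β₀ B₁ B₂ c₁ len (fun _ => True)) :
    ∀ (L : ℕ), 1 < L → ∀ (B₃ : ℝ), 4 < B₃ → ∃ a₁' O₁ : ℝ, 0 < a₁' ∧ 1 ≤ O₁ ∧
    ∀ (F : T3Family), F.L = L → ∀ (n K : ℕ) (hnK : n < K) (ε₁ : ℝ), 0 < ε₁ →
      ∀ V : GaugeField (F.P n) 0 (Matrix.specialUnitaryGroup (Fin 2) ℂ), PlaqSmall ε₁ V →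
        ∀ U₀ : GaugeField (F.P K) 0 (Matrix.specialUnitaryGroup (Fin 2) ℂ), RegPr F n K ((L : ℝ) ^ 3 * B₃ * ε₁) U₀ → U₀ ∈ fibre F ℰp n K hnK.le V →
          ε₁ ≤ a₁' → ∃ U ∈ regFibrePr F n K hnK.le (O₁ * (L : ℝ) ^ 3 * B₃ * ε₁) V,
            IsMinOn (fun W : GaugeField (F.P K) 0 (Matrix.specialUnitaryGroup (Fin 2) ℂ) => wilsonAction4 W)
              (regFibrePr F n K hnK.le (O₁ * (L : ℝ) ^ 3 * B₃ * ε₁) V) U := by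
  -- the ROOM-free ∃-package of row `norm_H₁` (px17 O2-R), at the coupling window `a₀ := 1`, `a₁ := max A₁ 1`, fed the displayed `hqG` letters
  obtain ⟨αN, BH, hαN, _hWN12, _hWN10, _hWN13, _hαNq, _hαN1, hBH, hN⟩ :=
    normHone_family_exists_allMembers c₀ cB (a₀ := 1) (a₁ := max A₁ 1) one_pos (le_max_right A₁ 1) αq qG hαq hqG hqGrow
  -- the cap: display cap ∧ the package's cap
  have hαcap₂ : ∀ L : ℕ, 1 < L → 0 < min (αcap L) (αN L) := fun L hL => lt_min (hαcap L hL) (hαN L hL)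
  have hle : ∀ L : ℕ, 1 < L → min (αcap L) (αN L) ≤ αcap L := fun L _ => min_le_left _ _
  have hle_αN : ∀ L : ℕ, 1 < L → min (αcap L) (αN L) ≤ αN L := fun L _ => min_le_right _ _
  -- the coupling window of the display's `a L i`: `1·(c₀∕cB)·t ≤ a L i ≤ max A₁ 1·(c₀∕cB)·t`
  have hlo : ∀ (L : ℕ) (i : Idx L), 1 * (c₀ L / cB L) * ((i.1.1.L : ℝ) ^ (i.1.2.2 - i.1.2.1)) ^ 3 ≤ a L i := fun L i => by
    rw [one_mul]; exact ha L i
  have hhi : ∀ (L : ℕ), 1 < L → ∀ (i : Idx L), a L i ≤ max A₁ 1 * (c₀ L / cB L) * ((i.1.1.L : ℝ) ^ (i.1.2.2 - i.1.2.1)) ^ 3 := fun L hL i => by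
    rw [mul_assoc]
    exact (hA₁ L hL i).trans (mul_le_mul_of_nonneg_right (le_max_left _ _)
      (mul_nonneg (div_nonneg (hc₀ L).out.le (hcB L).out.le) (pow_nonneg (pow_nonneg (Nat.cast_nonneg _) _) _)))
  -- ONE `exact` into S49 BY NAME at the cap; `B₀ ↦ max (B₀ L) (BH L)`; `norm_H₁` from the package at `a := a L i`; `norm_G` re-windowed and lifted to the max
  exact stubEX_of_chartPiecesTwS49
    (fun L => max (B₀ L) (BH L))
    (fun L hL => lt_max_of_lt_left (hB₀ L hL))
    (fun L => min (αcap L) (αN L))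
    hαcap₂ c₀ cB a ha A₁ hA₁
    (fun L hL i ρ U₀ hreg hρ hl f => (norm_G L hL i ρ U₀ hreg (hρ.trans (hle L hL)) hl f).trans (mul_le_mul_of_nonneg_right (le_max_left _ _) (norm_nonneg _)))
    (fun L hL i ρ U₀ hreg hρ hl b => (hN L hL i U₀ ρ hreg (hρ.trans (hle_αN L hL)) hl (a L i) (hlo L i) (hhi L hL i) b).trans (mul_le_mul_of_nonneg_right (le_max_right _ _) (norm_nonneg _)))
    hThm2S

end Summit.QuantumFields.YangMills.Theorems.Prop7StubEXOfChartPiecesTwS50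

end
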